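import Literature.NumberTheory.Automorphic.ReductiveGroupData
import Mathlib.LinearAlgebra.Matrix.Transvection
import Mathlib.Topology.Order.Compact
import HarnessLib

/-!
# `GL n 𝒪_F` is a maximal compact subgroup of `GL n F` — discharge of `glInt_isMaximalCompactOpen`

Topic `NumberTheory/Automorphic`; sibling proof file of `ReductiveGroupData`, discharging its named
fact

* `glInt_isMaximalCompactOpen n F` : for a non-archimedean local field `F`, every compact subgroup
  `K ≤ GL n F` containing `GL n 𝒪_F = glInt n F` equals it — "`K = GL(n, 𝔬)` is a maximal
  compact subgroup of `GL(n, F)`" (Bump, *Automorphic Forms and Representations* (1997), §4.5,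
  remark after Prop. 4.5.2 and Exercise 4.5.1; the fact's own pointers are Cartier,
  *Representations of `p`-adic groups: a survey*, and Tits, *Reductive groups over local
  fields*, §§3.2, 3.8, both in Corvallis 1979, Part 1),

as `glInt_isMaximalCompactOpen_holds`.

## The proof

We give a direct elementary argument (no Cartan decomposition, no lattices).  Let `K` be a
compact subgroup of `GL n F` containing the elementary transvections `1 + E_{ab}` (`a ≠ b`),
which lie in `GL n 𝒪_F`.  It suffices to show that every entry of every `k ∈ K` is integral
(then `k⁻¹ ∈ K` is integral too, so `k ∈ GL n 𝒪_F` by `mem_glInt_iff`).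

1. *A maximal entry exists* (`exists_forall_valuation_apply_le`): the map
   `(k, (a, b)) ↦ v(k_{ab})` is continuous from `GL n F × (Fin n × Fin n)` to the value group
   `Γ₀` with its `WithZeroTopology` (Mathlib's `IsValuativeTopology.continuous_valuation`), and
   `Γ₀` is order-closed for that topology, so on the compact set `K × univ` it attains a maximum
   `M = v((k₀)_{i₀ j₀})` (extreme value theorem `IsCompact.exists_isMaxOn`).
2. *An off-diagonal maximal entry is impossible if `M > 1`*: if `v(k_{ij}) = M` with `i ≠ j`,
   put `u = 1 + E_{ji} ∈ K`; then `(k u k - k k)_{ij} = (k E_{ji} k)_{ij} = k_{ij}²`, and both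
   `k u k, k k ∈ K`, so by the ultrametric inequality `M² = v(k_{ij}²) ≤ M`, contradicting `M > 1`.
3. *Reduction of the diagonal case*: if the maximum sits at `(j₀, j₀)` and there is another
   index `i₁ ≠ j₀`, the element `(1 + E_{i₁ j₀}) k₀ ∈ K` has `(i₁, j₀)`-entry
   `(k₀)_{i₁ j₀} + (k₀)_{j₀ j₀}`, of valuation `M` unless already `v((k₀)_{i₁ j₀}) = M`; either
   way we get an off-diagonal maximal entry.  If `Fin n` has the single element `j₀`, then
   `(k₀ k₀)_{j₀ j₀} = (k₀)_{j₀ j₀}²` directly gives `M² ≤ M`.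

Hence `M ≤ 1`, i.e. all entries of all elements of `K` are integral.

## Design notes

* Nothing in `ReductiveGroupData` is restated; consumers holding
  `(h : glInt_isMaximalCompactOpen n F)` are fed `glInt_isMaximalCompactOpen_holds n F`.
* The `WithZeroTopology` on `ValueGroupWithZero F` is only opened (scoped instance) for the
  extreme-value lemma `exists_forall_valuation_apply_le`.

## References

* D. Bump, *Automorphic Forms and Representations*, Cambridge Studies in Advanced Mathematics 55
  (1997), §4.5, Proposition 4.5.2 (remark following it) and Exercise 4.5.1 [Bump1997].
* P. Cartier, *Representations of `p`-adic groups: a survey*, Proc. Sympos. Pure Math. 33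
  (Corvallis 1979), Part 1, 111–155; J. Tits, *Reductive groups over local fields*, ibid.,
  29–69, §§3.2, 3.8 [Corvallis1979].
-/

universe u

open Matrix ValuativeRel
open scoped MatrixGroups

namespace Literature.NumberTheory.Automorphic

section Transvections

variable {n : ℕ} {F : Type u} [Field F] [ValuativeRel F]

/-- The entries of a transvection `1 + c • E_{ij}` with integral coefficient `c ∈ 𝒪[F]` are
integral. [folklore] -/
theorem transvection_apply_mem_integer {c : F} (hc : c ∈ 𝒪[F]) (i j a b : Fin n) :
    transvection i j c a b ∈ 𝒪[F] := by
  rw [transvection, Matrix.add_apply, Matrix.one_apply, Matrix.single_apply]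
  refine add_mem ?_ ?_
  · split_ifs
    · exact one_mem _
    · exact zero_mem _
  · split_ifs
    · exact hc
    · exact zero_mem _

/-- The elementary transvection `1 + E_{ij}` (`i ≠ j`) is (the underlying matrix of) an element
of `GL n 𝒪_F = glInt n F`, its inverse being `1 - E_{ij}`. [folklore] -/
theorem exists_mem_glInt_coe_eq_transvection {i j : Fin n} (hij : i ≠ j) :
    ∃ u ∈ glInt n F, ((u : GL (Fin n) F) : Matrix (Fin n) (Fin n) F) = transvection i j 1 := by
  refine ⟨⟨transvection i j 1, transvection i j (-1), ?_, ?_⟩, ?_, rfl⟩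
  · rw [transvection_mul_transvection_same i j hij, add_neg_cancel, transvection_zero]
  · rw [transvection_mul_transvection_same i j hij, neg_add_cancel, transvection_zero]
  · rw [mem_glInt_iff]
    exact ⟨fun a b => transvection_apply_mem_integer (one_mem _) i j a b,
      fun a b => transvection_apply_mem_integer (neg_mem (one_mem _)) i j a b⟩

end Transvections

section MaximalCompact

variable {n : ℕ} {F : Type u} [Field F] [ValuativeRel F] [TopologicalSpace F]
  [IsNonarchimedeanLocalField F]

open WithZeroTopology in
/-- **Extreme value step.**  On a compact subset `s` of `GL n F` containing some element, the
valuations of the matrix entries attain a maximum: there are `k₀ ∈ s` and indices `i₀ j₀` with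
`v(k_{ij}) ≤ v((k₀)_{i₀ j₀})` for all `k ∈ s` and all `i j`.  (The entry maps are continuous, the
valuation is continuous for the `WithZeroTopology` on the value group, which is order-closed, and
`s × univ` is compact.) [folklore] -/
theorem exists_forall_valuation_apply_le {s : Set (GL (Fin n) F)} (hs : IsCompact s)
    {k₁ : GL (Fin n) F} (hk₁ : k₁ ∈ s) (i₁ j₁ : Fin n) :
    ∃ k₀ ∈ s, ∃ i₀ j₀ : Fin n, ∀ k ∈ s, ∀ i j : Fin n,
      valuation F ((k : Matrix (Fin n) (Fin n) F) i j) ≤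
        valuation F ((k₀ : Matrix (Fin n) (Fin n) F) i₀ j₀) := by
  have hcont : Continuous fun p : GL (Fin n) F × (Fin n × Fin n) =>
      valuation F ((p.1 : Matrix (Fin n) (Fin n) F) p.2.1 p.2.2) := by
    refine continuous_prod_of_discrete_right.mpr fun q => ?_
    exact IsValuativeTopology.continuous_valuation.comp (Units.continuous_val.matrix_elem q.1 q.2)
  obtain ⟨p₀, hp₀, hmax⟩ := (hs.prod isCompact_univ).exists_isMaxOn
    ⟨(k₁, (i₁, j₁)), Set.mk_mem_prod hk₁ (Set.mem_univ _)⟩ hcont.continuousOn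
  refine ⟨p₀.1, (Set.mem_prod.mp hp₀).1, p₀.2.1, p₀.2.2, fun k hk i j => ?_⟩
  exact (isMaxOn_iff.mp hmax) (k, (i, j)) (Set.mk_mem_prod hk (Set.mem_univ (i, j)))

/-- **Integrality of compact overgroups of the transvections.**  If `K ≤ GL n F` is a compact
subgroup containing `GL n 𝒪_F`, then every entry of every `k ∈ K` has valuation `≤ 1`.
Proof: take a maximal entry valuation `M` over `K` (previous lemma); if `M > 1`, an off-diagonal
maximal entry `k_{ij}` gives `k_{ij}² = (k (1 + E_{ji}) k - k k)_{ij}` of valuation `M² ≤ M`,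
absurd, and a diagonal one is moved off the diagonal by a row transvection (or squared directly
when `n = 1`).  This is the content of Bump (1997), Exercise 4.5.1 ("`GL(n, 𝔬)` is a maximal
compact subgroup of `GL(n, F)`"). [cite: Bump1997, Exercise 4.5.1] -/
theorem valuation_apply_le_one_of_mem_of_isCompact (K : Subgroup (GL (Fin n) F))
    (hK : IsCompact (K : Set (GL (Fin n) F))) (hle : glInt n F ≤ K) {k : GL (Fin n) F}
    (hk : k ∈ K) (i j : Fin n) :
    valuation F ((k : Matrix (Fin n) (Fin n) F) i j) ≤ 1 := by
  by_contra! h1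
  obtain ⟨k₀, hk₀, i₀, j₀, hmax⟩ :=
    exists_forall_valuation_apply_le (s := (K : Set (GL (Fin n) F))) hK hk i j
  generalize hM : valuation F ((k₀ : Matrix (Fin n) (Fin n) F) i₀ j₀) = M at hmax
  have h1M : 1 < M := h1.trans_le (hmax k hk i j)
  have hMM : ¬ M * M ≤ M := by
    rw [not_le]
    simpa only [one_mul] using mul_lt_mul_of_pos_right h1M (zero_lt_one.trans h1M)
  -- an off-diagonal entry of valuation `M` is impossible
  have key : ∀ k' ∈ K, ∀ i' j' : Fin n, i' ≠ j' →
      valuation F ((k' : Matrix (Fin n) (Fin n) F) i' j') = M → False := by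
    intro k' hk' i' j' hij hval
    obtain ⟨u, hu, hu'⟩ := exists_mem_glInt_coe_eq_transvection (F := F) hij.symm
    have h₁ : k' * u * k' ∈ K := K.mul_mem (K.mul_mem hk' (hle hu)) hk'
    have h₂ : k' * k' ∈ K := K.mul_mem hk' hk'
    have hdiff : (k' : Matrix (Fin n) (Fin n) F) i' j' * (k' : Matrix (Fin n) (Fin n) F) i' j' =
        ((k' * u * k' : GL (Fin n) F) : Matrix (Fin n) (Fin n) F) i' j' -
          ((k' * k' : GL (Fin n) F) : Matrix (Fin n) (Fin n) F) i' j' := by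
      rw [Units.val_mul, Units.val_mul, Units.val_mul, hu', transvection, Matrix.mul_add,
        Matrix.add_mul, Matrix.mul_one, Matrix.add_apply, add_sub_cancel_left, Matrix.mul_assoc,
        Matrix.mul_apply, Finset.sum_eq_single j']
      · rw [Matrix.single_mul_apply_same, one_mul]
      · intro a _ ha
        rw [Matrix.single_mul_apply_of_ne (h := ha), mul_zero]
      · intro h
        exact absurd (Finset.mem_univ _) h
    apply hMM
    calc M * M = valuation F ((k' : Matrix (Fin n) (Fin n) F) i' j' *
          (k' : Matrix (Fin n) (Fin n) F) i' j') := by rw [map_mul, hval]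
      _ ≤ max (valuation F (((k' * u * k' : GL (Fin n) F) : Matrix (Fin n) (Fin n) F) i' j'))
          (valuation F (((k' * k' : GL (Fin n) F) : Matrix (Fin n) (Fin n) F) i' j')) := by
        rw [hdiff]
        exact Valuation.map_sub _ _ _
      _ ≤ M := max_le (hmax _ h₁ i' j') (hmax _ h₂ i' j')
  by_cases hi : i₀ = j₀
  · rw [hi] at hM
    by_cases hex : ∃ i₁, i₁ ≠ j₀
    · -- move the maximal diagonal entry off the diagonal by a row operation
      obtain ⟨i₁, hi₁⟩ := hex
      rcases (hmax k₀ hk₀ i₁ j₀).lt_or_eq with hlt | heq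
      · obtain ⟨u, hu, hu'⟩ := exists_mem_glInt_coe_eq_transvection (F := F) hi₁
        refine key (u * k₀) (K.mul_mem (hle hu) hk₀) i₁ j₀ hi₁ ?_
        rw [Units.val_mul, hu', transvection_mul_apply_same, one_mul]
        exact (Valuation.map_add_eq_of_lt_right _ (hlt.trans_eq hM.symm)).trans hM
      · exact key k₀ hk₀ i₁ j₀ hi₁ heq
    · -- `Fin n = {j₀}`: square directly
      push Not at hex
      apply hMM
      have hsq : ((k₀ * k₀ : GL (Fin n) F) : Matrix (Fin n) (Fin n) F) j₀ j₀ =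
          (k₀ : Matrix (Fin n) (Fin n) F) j₀ j₀ * (k₀ : Matrix (Fin n) (Fin n) F) j₀ j₀ := by
        rw [Units.val_mul, Matrix.mul_apply, Finset.sum_eq_single j₀]
        · intro a _ ha
          exact absurd (hex a) ha
        · intro h
          exact absurd (Finset.mem_univ _) h
      calc M * M = valuation F (((k₀ * k₀ : GL (Fin n) F) : Matrix (Fin n) (Fin n) F) j₀ j₀) := by
            rw [hsq, map_mul, hM]
        _ ≤ M := hmax _ (K.mul_mem hk₀ hk₀) j₀ j₀
  · exact key k₀ hk₀ i₀ j₀ hi hM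

variable (n : ℕ) (F : Type u) [Field F] [ValuativeRel F] [TopologicalSpace F]
  [IsNonarchimedeanLocalField F]

/-- **`GL n 𝒪_F` is a maximal compact subgroup of `GL n F`** (discharge of
`glInt_isMaximalCompactOpen`): a compact subgroup `K` of `GL n F` with `GL n 𝒪_F ≤ K` equals
`GL n 𝒪_F`.  Indeed every entry of every `k ∈ K` and of `k⁻¹ ∈ K` is integral
(`valuation_apply_le_one_of_mem_of_isCompact`), so `k ∈ GL n 𝒪_F` by `mem_glInt_iff`.
Ref: Bump (1997), §4.5, remark after Prop. 4.5.2 and Exercise 4.5.1 (verified locator); the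
fact's docstring points to Cartier and to Tits, §§3.2, 3.8, in Corvallis 1979, Part 1.
[cite: Bump1997, Exercise 4.5.1] -/
theorem glInt_isMaximalCompactOpen_holds : glInt_isMaximalCompactOpen n F := by
  intro K hK hle
  refine le_antisymm ?_ hle
  intro k hk
  rw [mem_glInt_iff]
  exact ⟨fun i j => (Valuation.mem_integer_iff _ _).mpr
      (valuation_apply_le_one_of_mem_of_isCompact K hK hle hk i j),
    fun i j => (Valuation.mem_integer_iff _ _).mpr
      (valuation_apply_le_one_of_mem_of_isCompact K hK hle (K.inv_mem hk) i j)⟩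

end MaximalCompact

end Literature.NumberTheory.Automorphic
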